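import Literature.NumberTheory.EllipticCurves.IwasawaSelmerDualProofs
import Literature.NumberTheory.GaloisRepresentations.AbsGaloisGroupCompact
import HarnessLib

/-!
# Restriction to a normal subgroup without fixed points: injective, with image the invariant classes
# (helper file 11 for crux 2 `GoodLatticeBDPValue`, stmt-BirchSwinnertonDyer-19032, cell `bsd-eis` seat `bsd-eis-k5-c2`)

The Galois-cohomological core of the CONTROL step (R3′) of the two-variable (Rubin) road
(HOME/k5-c2-MEMO-3.md §3 D5, ADDENDUM 2; ky MEMO-1 §3 R2 (ii)–(iii)): for normal subgroups
`S ≤ H` of `Γ_K`, `S` closed, and a discrete `Γ_K`-module `M` with open stabilisers and NO non-zero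
`S`-fixed point (`M^S = 0`), the restriction `res : H¹(H, M) → H¹(S, M)` (the tree's `resOfLe`) is

* INJECTIVE (`resOfLe_injective_of_fixedPoints_eq_zero`) — the kernel `H¹(H/S, M^S)` of
  inflation–restriction vanishes; proved directly on continuous crossed homomorphisms: a cocycle
  that is a coboundary `∂a` on `S` differs from `∂a` by a valuewise `S`-invariant, hence zero, function;
* has image EXACTLY the `H`-invariant classes (`exists_resOfLe_eq_of_forall_conjH1_eq`, with the
  converse the tree's `conjH1_resOfLe_of_mem`) — the transgression into `H²(H/S, M^S) = 0` vanishes;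
  proved by the explicit extension of an invariant cocycle `c` on `S` to `H`: `g ↦ m_g`, the UNIQUE
  (`M^S = 0`) element with `g·c(g⁻¹sg) − c(s) = s·m_g − m_g`, which is a crossed homomorphism on `H`
  restricting to `c`, continuous because it vanishes on an open normal subgroup of `Γ_K` fixing the
  finitely many values of `c` and meeting `S` inside the zero set of `c`.

Used with `S = Gal(K̄/K̃_∞) = pairKer κ κ₊ ≤ H = Gal(K̄/K_∞⁻) = ker κ`, `M = (F/𝓞)(θ)`, `θ|_{G_{K̃∞}} ≠ 𝟙`
(file `…TwoVariableSelmerControl`). HONEST FRAMING: generic Galois cohomology (NSW (1.6.7) in degree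
one with `A^H = 0`); closes nothing by itself. References: Neukirch–Schmidt–Wingberg (2008) (1.6.7);
Serre, *Galois Cohomology* I §2.6 (b); Rubin 1991 §4; HOME/bsd-eis-ky-MEMO-1.md §3 R2.
-/

-- the summit namespace `Summit.BirchSwinnertonDyer.BirchSwinnertonDyer` repeats the problem name by design (D-0017)
set_option linter.dupNamespace false
set_option autoImplicit false

noncomputable section

open scoped Classical

open Field Literature.NumberTheory.GaloisRepresentations Literature.NumberTheory.EllipticCurves

namespace Summit.BirchSwinnertonDyer.BirchSwinnertonDyer.Theorems.IwasawaTwoVariable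

universe u

/-! ## §1 Restriction and conjugation on explicit continuous cocycles -/

section Cocycles

variable {K : Type u} [Field K] {S H : Subgroup (absoluteGaloisGroup K)}
  {M : Type u} [AddCommGroup M] [DistribMulAction (absoluteGaloisGroup K) M] [TopologicalSpace M]
  [DiscreteTopology M]

/-- `res [c] = [c|_S]` for the tree's `resOfLe` (theorems only: the restricted cocycle
`c|_S = c ∘ (S ↪ H)` is the tree's `contOneCocycles.pullback` along the pair `(S ↪ H, id_M)`, whose
value at `s` is `c s` definitionally). [folklore] -/
theorem resOfLe_oneCocycleClass (h : S ≤ H) (c : contOneCocycles (discreteTopRep H M)) :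
    resOfLe M h (oneCocycleClass (discreteTopRep H M) c) =
      oneCocycleClass (discreteTopRep S M) (contOneCocycles.pullback (subgroupInclusion h)
        (resHomOfEquivariant (subgroupInclusion h) (AddMonoidHom.id M) fun _ _ ↦ rfl) c) := by
  rw [resOfLe, resH1Hom]
  change ContinuousCohomology.map _ _ 1 (oneCocycleClass (discreteTopRep H M) c) = _
  rw [map_oneCocycleClass]

variable [S.Normal]

omit [TopologicalSpace M] [DiscreteTopology M] in
/-- The pair `(s ↦ τ⁻¹ s τ, m ↦ τ • m)` is compatible (the variance of `conjH1`). [folklore] -/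
theorem smul_subgroupConj_compat (τ : absoluteGaloisGroup K) (x : S) (m : M) :
    DistribSMul.toAddMonoidHom M τ (subgroupConj S τ x • m) =
      x • DistribSMul.toAddMonoidHom M τ m := by
  simp only [DistribSMul.toAddMonoidHom_apply, Subgroup.smul_def, subgroupConj_apply_coe,
    smul_smul, mul_assoc, mul_inv_cancel_left]

/-- `conj_τ [c] = [τ · c]` for the tree's `conjH1` (theorems only: the conjugated cocycle
`(τ · c)(s) = τ • c(τ⁻¹ s τ)` is the tree's `contOneCocycles.pullback` along the pair
`(s ↦ τ⁻¹sτ, m ↦ τ • m)`, with that value definitionally; cf. `conjCocycle` of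
`H1CorestrictionIndexTwo`). [folklore] -/
theorem conjH1_oneCocycleClass_of (τ : absoluteGaloisGroup K)
    (c : contOneCocycles (discreteTopRep S M)) :
    conjH1 S M τ (oneCocycleClass (discreteTopRep S M) c) =
      oneCocycleClass (discreteTopRep S M) (contOneCocycles.pullback (subgroupConj S τ)
        (resHomOfEquivariant (subgroupConj S τ) (DistribSMul.toAddMonoidHom M τ)
          (smul_subgroupConj_compat τ)) c) :=
  map_oneCocycleClass (X := discreteTopRep S M) (Y := discreteTopRep S M) (subgroupConj S τ)
    (resHomOfEquivariant (subgroupConj S τ) (DistribSMul.toAddMonoidHom M τ)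
      (smul_subgroupConj_compat τ)) c

/-- If `conj_τ [c] = [c]` then `τ • c(τ⁻¹ s τ) − c(s) = s • v − v` for some `v ∈ M`. [folklore] -/
theorem exists_conj_sub_eq_of_conjH1_eq (τ : absoluteGaloisGroup K)
    (c : contOneCocycles (discreteTopRep S M))
    (h : conjH1 S M τ (oneCocycleClass (discreteTopRep S M) c) =
      oneCocycleClass (discreteTopRep S M) c) :
    ∃ v : M, ∀ s : S, τ • c.1 (subgroupConj S τ s) - c.1 s =
      (s : absoluteGaloisGroup K) • v - v := by
  rw [conjH1_oneCocycleClass_of, ← sub_eq_zero, ← oneCocycleClass_sub,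
    oneCocycleClass_eq_zero_iff] at h
  obtain ⟨v, hv⟩ := h
  exact ⟨v, fun s ↦ hv s⟩

/-- Every continuous cocycle on a CLOSED normal `S` with values in a discrete module with open
stabilisers is fixed VALUEWISE by conjugation by an open normal subgroup of `Γ_K`:
`τ • c(τ⁻¹ s τ) = c(s)` for `τ ∈ Nrm` (fix the finitely many values; meet `S` inside the zero set).
The cocycle-level form of the tree's (A1) `GreenbergSelmer.exists_openNormalSubgroup_conjH1_eq`.
[folklore] -/
theorem exists_openNormalSubgroup_conj_apply_eq
    (hS : IsClosed ((S : Subgroup (absoluteGaloisGroup K)) : Set (absoluteGaloisGroup K)))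
    (hstab : ∀ m : M,
      IsOpen (MulAction.stabilizer (absoluteGaloisGroup K) m : Set (absoluteGaloisGroup K)))
    (c : contOneCocycles (discreteTopRep S M)) :
    ∃ Nrm : OpenNormalSubgroup (absoluteGaloisGroup K), ∀ τ ∈ Nrm, ∀ s : S,
      τ • c.1 (subgroupConj S τ s) = c.1 s := by
  haveI : CompactSpace (absoluteGaloisGroup K) := absoluteGaloisGroup_compactSpace K
  haveI : CompactSpace S := isCompact_iff_compactSpace.mp hS.isCompact
  have hfin : (Set.range c.1).Finite := (isCompact_range c.1.continuous).finite_of_discrete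
  set Ufix : Set (absoluteGaloisGroup K) := {τ | ∀ m ∈ Set.range c.1, τ • m = m} with hUfix_def
  have hUfix : IsOpen Ufix := by
    have e : Ufix = ⋂ m ∈ Set.range c.1,
        (MulAction.stabilizer (absoluteGaloisGroup K) m : Set (absoluteGaloisGroup K)) := by
      ext τ
      simp only [hUfix_def, Set.mem_setOf_eq, Set.mem_iInter, SetLike.mem_coe,
        MulAction.mem_stabilizer_iff]
    rw [e]
    exact hfin.isOpen_biInter fun m _ ↦ hstab m
  have hz : IsOpen {h : S | c.1 h = 0} := (isOpen_discrete ({0} : Set M)).preimage c.1.continuous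
  obtain ⟨U0, hU0, hU0eq⟩ := isOpen_induced_iff.mp hz
  have h1fix : (1 : absoluteGaloisGroup K) ∈ Ufix := fun m _ ↦ one_smul _ m
  have h1U0 : (1 : absoluteGaloisGroup K) ∈ U0 := by
    have : (1 : S) ∈ Subtype.val ⁻¹' U0 := by
      rw [hU0eq]
      exact contOneCocycles.apply_one c
    exact this
  obtain ⟨Nrm, hNrm⟩ := ProfiniteGrp.exist_openNormalSubgroup_sub_open_nhds_of_one
    (hUfix.inter hU0) ⟨h1fix, h1U0⟩
  refine ⟨Nrm, fun τ hτ s ↦ ?_⟩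
  have hn : ((s : absoluteGaloisGroup K)⁻¹ * τ⁻¹ * s * τ) ∈ S := by
    have h1 : τ⁻¹ * (s : absoluteGaloisGroup K) * τ⁻¹⁻¹ ∈ S :=
      Subgroup.Normal.conj_mem inferInstance _ s.2 τ⁻¹
    rw [inv_inv] at h1
    have := S.mul_mem (S.inv_mem s.2) h1
    simpa only [mul_assoc] using this
  have hnN : ((s : absoluteGaloisGroup K)⁻¹ * τ⁻¹ * s * τ) ∈ Nrm := by
    have h1 : (s : absoluteGaloisGroup K)⁻¹ * τ⁻¹ * (s : absoluteGaloisGroup K)⁻¹⁻¹ ∈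
        Nrm.toSubgroup :=
      Subgroup.Normal.conj_mem inferInstance _ (Nrm.toSubgroup.inv_mem hτ) _
    rw [inv_inv] at h1
    exact Nrm.toSubgroup.mul_mem h1 hτ
  have hcn : c.1 ⟨_, hn⟩ = 0 := by
    have hn0 : (⟨_, hn⟩ : S) ∈ Subtype.val ⁻¹' U0 := (hNrm hnN).2
    rw [hU0eq] at hn0
    exact hn0
  have hconj : subgroupConj S τ s = s * ⟨_, hn⟩ := Subtype.ext (by
    simp only [subgroupConj_apply_coe, Subgroup.coe_mul, mul_assoc, mul_inv_cancel_left])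
  rw [hconj, c.2 s ⟨_, hn⟩, hcn, map_zero, add_zero]
  exact (hNrm hτ).1 _ ⟨s, rfl⟩

end Cocycles

/-! ## §2 No `S`-fixed points: injectivity of restriction -/

section NoFixed

variable {K : Type u} [Field K] {S H : Subgroup (absoluteGaloisGroup K)}
  {M : Type u} [AddCommGroup M] [DistribMulAction (absoluteGaloisGroup K) M] [TopologicalSpace M]
  [DiscreteTopology M]

omit [TopologicalSpace M] [DiscreteTopology M] in
/-- If `M^S = 0`, an element is determined by its coboundary on `S`. [folklore] -/
theorem eq_of_forall_smul_sub_eq (hMS : ∀ m : M, (∀ s ∈ S, s • m = m) → m = 0) {a b : M}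
    (h : ∀ s : S, (s : absoluteGaloisGroup K) • a - a = (s : absoluteGaloisGroup K) • b - b) :
    a = b := by
  refine sub_eq_zero.mp (hMS (a - b) fun s hs ↦ ?_)
  have h' := sub_eq_sub_iff_sub_eq_sub.mp (h ⟨s, hs⟩)
  rw [smul_sub]
  exact h'

/-- **`res : H¹(H, M) → H¹(S, M)` is injective when `M^S = 0`** (`S ≤ H`, `S` normal in `Γ_K`): if
`c|_S = ∂a` then `g ↦ c(g) − (g·a − a)` is `S`-invariant valuewise (compare `c(s·g)` with
`c(g · g⁻¹sg)`), hence zero. The degree-one inflation–restriction kernel `H¹(H/S, M^S) = 0`.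
[cite: NeukirchSchmidtWingberg2008, (1.6.7)] -/
theorem resOfLe_injective_of_fixedPoints_eq_zero [S.Normal] (hSH : S ≤ H)
    (hMS : ∀ m : M, (∀ s ∈ S, s • m = m) → m = 0) :
    Function.Injective (resOfLe M hSH) := by
  refine (injective_iff_map_eq_zero _).2 fun x hx ↦ ?_
  obtain ⟨c, rfl⟩ := oneCocycleClass_surjective _ x
  rw [resOfLe_oneCocycleClass, oneCocycleClass_eq_zero_iff] at hx
  obtain ⟨a, ha⟩ := hx
  rw [oneCocycleClass_eq_zero_iff]
  refine ⟨a, fun g ↦ ?_⟩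
  change c.1 g = (g : absoluteGaloisGroup K) • a - a
  have key : ∀ s : S, (s : absoluteGaloisGroup K) • (c.1 g - ((g : absoluteGaloisGroup K) • a - a)) =
      c.1 g - ((g : absoluteGaloisGroup K) • a - a) := by
    intro s
    have hu : (g : absoluteGaloisGroup K)⁻¹ * s * g ∈ S := conj_mem_of_normal S g s
    set s' : H := ⟨s, hSH s.2⟩ with hs'
    set t : H := ⟨(g : absoluteGaloisGroup K)⁻¹ * s * g, hSH hu⟩ with ht
    have hprod : s' * g = g * t := Subtype.ext (by
      simp only [hs', ht, Subgroup.coe_mul, mul_assoc, mul_inv_cancel_left])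
    have Ha : c.1 s' = (s : absoluteGaloisGroup K) • a - a := ha s
    have Ht : c.1 t = ((g : absoluteGaloisGroup K)⁻¹ * s * g) • a - a := ha ⟨_, hu⟩
    have h1 : c.1 (s' * g) = c.1 s' + (s : absoluteGaloisGroup K) • c.1 g := c.2 s' g
    have h2 : c.1 (g * t) = c.1 g + (g : absoluteGaloisGroup K) • c.1 t := c.2 g t
    have hsg : (g : absoluteGaloisGroup K) * ((g : absoluteGaloisGroup K)⁻¹ * s * g) =
        (s : absoluteGaloisGroup K) * g := by
      simp only [mul_assoc, mul_inv_cancel_left]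
    rw [hprod, h2, Ht, smul_sub, smul_smul, hsg, mul_smul, Ha] at h1
    -- h1 : c g + (s • g • a − g • a) = (s • a − a) + s • c g
    have E := sub_eq_zero.mpr h1.symm
    rw [← sub_eq_zero, smul_sub, smul_sub]
    convert E using 1
    abel
  exact sub_eq_zero.mp (hMS _ fun s hs ↦ key ⟨s, hs⟩)

end NoFixed

/-! ## §3 The image of restriction is the invariant classes -/

section Lift

variable {K : Type u} [Field K] {S H : Subgroup (absoluteGaloisGroup K)} [S.Normal]
  {M : Type u} [AddCommGroup M] [DistribMulAction (absoluteGaloisGroup K) M] [TopologicalSpace M]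
  [DiscreteTopology M]

/-- **An `H`-invariant class of `H¹(S, M)` lifts to `H¹(H, M)` when `M^S = 0`** (`S ≤ H` normal in
`Γ_K`, `S` closed, `M` discrete with open stabilisers): if `conj_g x = x` for every `g ∈ H` then
`x = res y` for some `y`. With `x = [c]`, invariance gives for each `g` an element `m_g`, UNIQUE by
`M^S = 0`, with `g·c(g⁻¹sg) − c(s) = s·m_g − m_g`; uniqueness makes `g ↦ m_g` a crossed homomorphism
on `H` with `m_s = c(s)` on `S`, and it vanishes on an open normal subgroup fixing `c` valuewise
(`exists_openNormalSubgroup_conj_apply_eq`), so it is continuous. The degree-one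
inflation–restriction statement "`H¹(H, M) → H¹(S, M)^{H/S}` is onto when `H²(H/S, M^S) = 0`" for
`M^S = 0`. [cite: NeukirchSchmidtWingberg2008, (1.6.7)] -/
theorem exists_resOfLe_eq_of_forall_conjH1_eq (hSH : S ≤ H)
    (hS : IsClosed ((S : Subgroup (absoluteGaloisGroup K)) : Set (absoluteGaloisGroup K)))
    (hstab : ∀ m : M,
      IsOpen (MulAction.stabilizer (absoluteGaloisGroup K) m : Set (absoluteGaloisGroup K)))
    (hMS : ∀ m : M, (∀ s ∈ S, s • m = m) → m = 0)
    (x : subgroupH1 S M) (hx : ∀ g ∈ H, conjH1 S M g x = x) :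
    ∃ y : subgroupH1 H M, resOfLe M hSH y = x := by
  obtain ⟨c, rfl⟩ := oneCocycleClass_surjective _ x
  have hval : ∀ g : H, ∃ v : M, ∀ s : S,
      (g : absoluteGaloisGroup K) • c.1 (subgroupConj S (g : absoluteGaloisGroup K) s) - c.1 s =
        (s : absoluteGaloisGroup K) • v - v :=
    fun g ↦ exists_conj_sub_eq_of_conjH1_eq (g : absoluteGaloisGroup K) c (hx g g.2)
  choose m hm using hval
  -- (i) `m` restricts to `c` on `S`
  have hmS : ∀ s₀ : S, m ⟨s₀, hSH s₀.2⟩ = c.1 s₀ := fun s₀ ↦ by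
    refine eq_of_forall_smul_sub_eq hMS fun s ↦ ?_
    rw [← hm ⟨s₀, hSH s₀.2⟩ s]
    change (s₀ : absoluteGaloisGroup K) • c.1 (subgroupConj S (s₀ : absoluteGaloisGroup K) s) -
      c.1 s = _
    have hprod : s₀ * subgroupConj S (s₀ : absoluteGaloisGroup K) s = s * s₀ := Subtype.ext (by
      simp only [subgroupConj_apply_coe, Subgroup.coe_mul, mul_assoc, mul_inv_cancel_left])
    have h1 : c.1 (s₀ * subgroupConj S (s₀ : absoluteGaloisGroup K) s) =
        c.1 s₀ + (s₀ : absoluteGaloisGroup K) • c.1 (subgroupConj S (s₀ : absoluteGaloisGroup K) s) :=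
      c.2 _ _
    have h2 : c.1 (s * s₀) = c.1 s + (s : absoluteGaloisGroup K) • c.1 s₀ := c.2 _ _
    rw [hprod, h2] at h1
    have E := sub_eq_zero.mpr h1.symm
    rw [← sub_eq_zero]
    convert E using 1
    abel
  -- (ii) `m` is a crossed homomorphism on `H`
  have hmul : ∀ g h : H, m (g * h) = m g + (g : absoluteGaloisGroup K) • m h := fun g h ↦ by
    refine eq_of_forall_smul_sub_eq hMS fun s ↦ ?_
    rw [← hm (g * h) s]
    set s' : S := subgroupConj S (g : absoluteGaloisGroup K) s with hs'
    have A : (h : absoluteGaloisGroup K) • c.1 (subgroupConj S (h : absoluteGaloisGroup K) s') =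
        c.1 s' + ((s' : absoluteGaloisGroup K) • m h - m h) :=
      sub_eq_iff_eq_add'.mp (hm h s')
    have B : (g : absoluteGaloisGroup K) • c.1 s' =
        c.1 s + ((s : absoluteGaloisGroup K) • m g - m g) :=
      sub_eq_iff_eq_add'.mp (hm g s)
    have hcomp : subgroupConj S ((g * h : H) : absoluteGaloisGroup K) s =
        subgroupConj S (h : absoluteGaloisGroup K) s' := by
      rw [hs', Subgroup.coe_mul, ← subgroupConj_comp]
      rfl
    have hsg : (g : absoluteGaloisGroup K) * (s' : absoluteGaloisGroup K) =
        (s : absoluteGaloisGroup K) * g := by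
      rw [hs', subgroupConj_apply_coe]
      simp only [mul_assoc, mul_inv_cancel_left]
    rw [hcomp, Subgroup.coe_mul, mul_smul, A, smul_add, B, smul_sub, smul_smul, hsg, mul_smul,
      smul_add]
    abel
  -- (iii) `m` vanishes on an open normal subgroup fixing `c` valuewise
  obtain ⟨Nrm, hNrm⟩ := exists_openNormalSubgroup_conj_apply_eq hS hstab c
  have hm0 : ∀ g : H, (g : absoluteGaloisGroup K) ∈ Nrm → m g = 0 := fun g hg ↦ by
    refine eq_of_forall_smul_sub_eq hMS fun s ↦ ?_
    rw [← hm g s, hNrm _ hg s, sub_self, smul_zero, sub_self]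
  -- (iv) hence `m` is continuous (locally constant)
  have hcont : Continuous m := by
    refine continuous_def.2 fun U _ ↦ ?_
    rw [isOpen_iff_forall_mem_open]
    intro g₀ hg₀
    refine ⟨(fun g : H ↦ ((g₀⁻¹ * g : H) : absoluteGaloisGroup K)) ⁻¹'
        ((Nrm : Subgroup (absoluteGaloisGroup K)) : Set (absoluteGaloisGroup K)), ?_, ?_, ?_⟩
    · intro g hg
      have hg' : ((g₀⁻¹ * g : H) : absoluteGaloisGroup K) ∈ Nrm := hg
      have e : m g = m g₀ := by
        rw [← mul_inv_cancel_left g₀ g, hmul, hm0 _ hg', smul_zero, add_zero]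
      show m g ∈ U
      rw [e]
      exact hg₀
    · exact Nrm.isOpen.preimage (continuous_subtype_val.comp (continuous_const.mul continuous_id))
    · show ((g₀⁻¹ * g₀ : H) : absoluteGaloisGroup K) ∈ Nrm
      rw [inv_mul_cancel]
      exact one_mem _
  -- (v) the extended cocycle restricts to `c`
  let cH : contOneCocycles (discreteTopRep H M) :=
    ⟨⟨m, hcont⟩, fun g h ↦ by
      change m (g * h) = m g + (g : absoluteGaloisGroup K) • m h
      exact hmul g h⟩
  refine ⟨oneCocycleClass (discreteTopRep H M) cH, ?_⟩
  rw [resOfLe_oneCocycleClass]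
  congr 1
  apply Subtype.ext
  ext s
  exact hmS s

/-- **The image of `res : H¹(H, M) → H¹(S, M)` is EXACTLY the `H`-invariant classes** (`M^S = 0`,
`S ≤ H` normal in `Γ_K`, `S` closed, open stabilisers): `x ∈ range res ↔ ∀ g ∈ H, conj_g x = x`
(the converse direction is the tree's `conjH1_resOfLe_of_mem`: inner automorphisms act trivially).
[cite: NeukirchSchmidtWingberg2008, (1.6.7)] -/
theorem mem_range_resOfLe_iff_forall_conjH1_eq [H.Normal] (hSH : S ≤ H)
    (hS : IsClosed ((S : Subgroup (absoluteGaloisGroup K)) : Set (absoluteGaloisGroup K)))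
    (hstab : ∀ m : M,
      IsOpen (MulAction.stabilizer (absoluteGaloisGroup K) m : Set (absoluteGaloisGroup K)))
    (hMS : ∀ m : M, (∀ s ∈ S, s • m = m) → m = 0) (x : subgroupH1 S M) :
    x ∈ (resOfLe M hSH).range ↔ ∀ g ∈ H, conjH1 S M g x = x := by
  constructor
  · rintro ⟨y, rfl⟩ g hg
    exact conjH1_resOfLe_of_mem (M := M) hSH hg y
  · intro hx
    obtain ⟨y, hy⟩ := exists_resOfLe_eq_of_forall_conjH1_eq hSH hS hstab hMS x hx
    exact ⟨y, hy⟩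

end Lift

end Summit.BirchSwinnertonDyer.BirchSwinnertonDyer.Theorems.IwasawaTwoVariable

end
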